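import Mathlib
import Summits.ValiantsHypothesis.ValiantsHypothesis.Theorems.BarrierLeverPartitionMinorsHitByVPHiddenStatesSecondShellNestedRows
import Summits.ValiantsHypothesis.ValiantsHypothesis.Theorems.BarrierLeverPartitionMinorsHitByVPHiddenStatesSecondShellPrescribed
import Summits.ValiantsHypothesis.ValiantsHypothesis.Theorems.BarrierLeverPartitionMinorsHitByVPHiddenStatesSecondShellCrossTemplate
import Summits.ValiantsHypothesis.ValiantsHypothesis.Theorems.BarrierLeverPartitionMinorsHitByVPHiddenStatesSecondShellChainFourSharp
import Summits.ValiantsHypothesis.ValiantsHypothesis.Theorems.BarrierLeverPartitionMinorsHitByVPHiddenStatesSecondShellNested24Z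

/-!
# Route BarrierLever — item `PartitionMinorsHitByVP` (stmt-ValiantsHypothesis-19717), line `hidden-states`:
# ★★ THE DOUBLY-INERT CELL — `Y₁ = {p,q} ⊆ A₂ ∩ C₂`, `Y₂ = {v,w} ⊆ A₁ ∩ C₁` (every `t, h`)

Helper file (`--supports stmt-ValiantsHypothesis-19717`; cell valiant-natproofs, 𝒟-side door (c), registered line
`Cruxes/PartitionMinorsHitByVP/Lines/hidden_states.lean` v8; prover seat val-np-p6 gen 18).  Closes NO item; definition-free.

THE LAST t = 4 SHAPE.  `C₁∖A₁ = {p, q}` (attachment `x₀` at `p`), `C₂∖A₂ = {v, w}` (attachment `f₀` at `v`), each swap's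
Y-nodes INERT in the other: `p, q ∈ A₂ ∩ C₂`, `v, w ∈ A₁ ∩ C₁`.  The start row `C₁ = Z ∪ {p, q, v, w}`, `Z = (A₁ ∩ C₁) ∖ {v, w}`,
of `D_{B − A₂ + C₁}` has four movers whose digraph is TWO DISJOINT TWO-CHAINS `q → p → x₀` (table 1) and `w → v → f₀` (table
2) — a DEGENERATE four-chain `w → v ↛ q → p` with `σ₂ = 0`, admitted by the sharp four-mover chain lemma
(`…SecondShellChainFourSharp.det_eq_zero_of_chain₄'`): with `σ₂ = 0` every pure pair/triple coefficient vanishes, the rows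
through `v` or `w` lie outside `A₂`, and the one critical row `Z ∪ {p, q, f₀} = A₂` would force `C₁ = C₂`.  ★★
`exists_table_secondShell_doublyInert`.  EXACT t = 4 CENSUS (kit j323376): shape ((2,2),0,0,2,4), the last 3 780 families of
B₄(9) — with this cell the ENTIRE second shell of B₄(9) (52 672 410 families) is served by kernel ∀t,h cells.

HONEST LABEL: conjecture-column cell (second shell, every `t, h`); 19717 stays OPEN; nothing on crux 14610 or VP ≠ VNP.
-/

set_option linter.dupNamespace false

namespace Summit.ValiantsHypothesis.ValiantsHypothesis.Theorems.BarrierLever.HiddenStates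

open Finset

noncomputable section

namespace SecondShell

open PathTable

/-! ## ★★ The doubly-inert cell -/

set_option maxHeartbeats 400000 in
/-- ★★ **SECOND SHELL, DOUBLY-INERT CLASSES, EVERY `t, h`.**  `C₁∖A₁ = {p,q} ⊆ A₂ ∩ C₂`, `C₂∖A₂ = {v,w} ⊆ A₁ ∩ C₁`: the class
is served by a two-parameter path table. -/
theorem exists_table_secondShell_doublyInert (h t : ℕ) (A₁ A₂ C₁ C₂ : Finset (Fin h))
    (hA₁ : A₁.card = t) (hA₂ : A₂.card = t) (hC₁ : C₁.card = t + 1) (hC₂ : C₂.card = t + 1)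
    (h₁ : ¬ A₁ ⊆ C₁) (h₂ : ¬ A₂ ⊆ C₂) (hA : A₁ ≠ A₂) (hC : C₁ ≠ C₂)
    {yp yq yv yw : Fin h}
    (hY₁ : C₁ \ A₁ = {yp, yq}) (hpq : yp ≠ yq) (hY₂ : C₂ \ A₂ = {yv, yw}) (hvw : yv ≠ yw)
    (hpA : yp ∈ A₂) (hpC : yp ∈ C₂) (hqA : yq ∈ A₂) (hqC : yq ∈ C₂)
    (hvA : yv ∈ A₁) (hvC : yv ∈ C₁) (hwA : yw ∈ A₁) (hwC : yw ∈ C₁)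
    {r : ℕ} (u cols : Fin r → Finset (Fin h)) (hu : Function.Injective u)
    (hU : ∀ i, ((u i).card ≤ t ∧ u i ≠ A₁ ∧ u i ≠ A₂) ∨ u i = C₁ ∨ u i = C₂)
    (hcols : ∀ J : Finset (Fin h), J.card ≤ t → ∃ kk, cols kk = J) :
    ∃ tx : Option (Fin h) → Fin h → ℂ,
      (Matrix.of fun i kk : Fin r => ∏ a ∈ u i, (tx none a + ∑ q ∈ cols kk, tx (some q) a)).det ≠ 0 := by
  classical
  obtain ⟨k₁, j₁, j₁', hk₁, hkj₁, a1, a2, a3, a4⟩ := swap_sizes A₁ C₁ hA₁ hC₁ h₁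
  obtain ⟨k₂, j₂, j₂', hk₂, hkj₂, b1, b2, b3, b4⟩ := swap_sizes A₂ C₂ hA₂ hC₂ h₂
  have hY₁c : (C₁ \ A₁).card = 2 := by rw [hY₁, Finset.card_pair hpq]
  have hY₂c : (C₂ \ A₂).card = 2 := by rw [hY₂, Finset.card_pair hvw]
  obtain rfl : k₁ = 1 := by omega
  obtain rfl : k₂ = 1 := by omega
  -- membership and distinctness
  have hyp₁ : yp ∈ C₁ \ A₁ := by rw [hY₁]; simp
  have hyq₁ : yq ∈ C₁ \ A₁ := by rw [hY₁]; simp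
  have hyv₂ : yv ∈ C₂ \ A₂ := by rw [hY₂]; simp
  have hyw₂ : yw ∈ C₂ \ A₂ := by rw [hY₂]; simp
  obtain ⟨⟨hypC₁, hypA₁⟩, ⟨hyqC₁, hyqA₁⟩⟩ := And.intro (Finset.mem_sdiff.1 hyp₁) (Finset.mem_sdiff.1 hyq₁)
  obtain ⟨⟨hyvC₂, hyvA₂⟩, ⟨hywC₂, hywA₂⟩⟩ := And.intro (Finset.mem_sdiff.1 hyv₂) (Finset.mem_sdiff.1 hyw₂)
  have hpv : yp ≠ yv := fun h' => hypA₁ (h' ▸ hvA)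
  have hpw : yp ≠ yw := fun h' => hypA₁ (h' ▸ hwA)
  have hqv : yq ≠ yv := fun h' => hyqA₁ (h' ▸ hvA)
  have hqw : yq ≠ yw := fun h' => hyqA₁ (h' ▸ hwA)
  -- attachments
  obtain ⟨x₀, hX₁⟩ := Finset.card_eq_one.1 a2
  obtain ⟨f₀, hX₂⟩ := Finset.card_eq_one.1 b2
  have hx₀ : x₀ ∈ A₁ \ C₁ := by rw [hX₁]; simp
  have hf₀ : f₀ ∈ A₂ \ C₂ := by rw [hX₂]; simp
  -- transports: path 1 = (p < q), x₀ at p; path 2 = (v < w), f₀ at v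
  have hmemY₁ : ∀ i, ![yp, yq] i ∈ C₁ \ A₁ := by
    intro i; fin_cases i
    · exact hyp₁
    · exact hyq₁
  have hmemY₂ : ∀ i, ![yv, yw] i ∈ C₂ \ A₂ := by
    intro i; fin_cases i
    · exact hyv₂
    · exact hyw₂
  have hmemX₁ : ∀ i, ![x₀] i ∈ A₁ \ C₁ := by intro i; fin_cases i; exact hx₀
  have hmemX₂ : ∀ i, ![f₀] i ∈ A₂ \ C₂ := by intro i; fin_cases i; exact hf₀
  have hinj1 : ∀ x : Fin h, Function.Injective ![x] := fun x i i' _ => by fin_cases i; fin_cases i'; rfl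
  obtain ⟨e₁, m1, m2, m3, m4, hpy₁, hpx₁⟩ := exists_equiv_prescribed A₁ C₁ a1 a2 a3 a4 _ (injective_vec2 hpq) hmemY₁ _
    (hinj1 x₀) hmemX₁
  obtain ⟨e₂, n1, n2, n3, n4, hpy₂, hpx₂⟩ := exists_equiv_prescribed A₂ C₂ b1 b2 b3 b4 _ (injective_vec2 hvw) hmemY₂ _
    (hinj1 f₀) hmemX₂
  have he₁p : e₁ (Sum.inl (Sum.inl 0)) = yp := by rw [hpy₁]; rfl
  have he₁q : e₁ (Sum.inl (Sum.inl 1)) = yq := by rw [hpy₁]; rfl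
  have he₁x : e₁ (Sum.inl (Sum.inr 0)) = x₀ := by rw [hpx₁]; rfl
  have he₂v : e₂ (Sum.inl (Sum.inl 0)) = yv := by rw [hpy₂]; rfl
  have he₂w : e₂ (Sum.inl (Sum.inl 1)) = yw := by rw [hpy₂]; rfl
  have he₂f : e₂ (Sum.inl (Sum.inr 0)) = f₀ := by rw [hpx₂]; rfl
  refine exists_table_secondShell_of_cross h t A₁ A₂ C₁ C₂ hA₁ hA₂ hC₁ hC₂ hA hC hk₁ hkj₁ hk₂ hkj₂ e₁ m1 m2 m3 m4
    e₂ n1 n2 n3 n4 u cols hu hU hcols (Or.inr ?_)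
  intro rows i₀ hrow₀ key hcolcard ε
  -- table facts
  have R₁ := fun d => path₁_reads e₁ he₁p he₁q he₁x d
  have R₂ := fun d => path₁_reads e₂ he₂v he₂w he₂f d
  have v₁pq := path₁_zero e₁ he₁p he₁q
  have v₂vw := path₁_zero e₂ he₂v he₂w
  have v₂p : ∀ d, swapTable' e₂ yp d = if d = yp then 1 else 0 := row_unit A₂ C₂ e₂ n1 (fun h' => (Finset.mem_sdiff.1 h').2 hpA)
  have v₂q : ∀ d, swapTable' e₂ yq d = if d = yq then 1 else 0 := row_unit A₂ C₂ e₂ n1 (fun h' => (Finset.mem_sdiff.1 h').2 hqA)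
  have v₁v : ∀ d, swapTable' e₁ yv d = if d = yv then 1 else 0 := row_unit A₁ C₁ e₁ m1 (fun h' => (Finset.mem_sdiff.1 h').2 hvA)
  have v₁w : ∀ d, swapTable' e₁ yw d = if d = yw then 1 else 0 := row_unit A₁ C₁ e₁ m1 (fun h' => (Finset.mem_sdiff.1 h').2 hwA)
  have v₁pv : swapTable' e₁ yp yv = 0 := by
    by_contra h'; exact (Finset.mem_sdiff.1 hx₀).2 (((R₁ yv).1 h' hpv.symm) ▸ hvC)
  have v₁pw : swapTable' e₁ yp yw = 0 := by
    by_contra h'; exact (Finset.mem_sdiff.1 hx₀).2 (((R₁ yw).1 h' hpw.symm) ▸ hwC)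
  have v₁qv : swapTable' e₁ yq yv = 0 := by by_contra h'; exact hpv.symm ((R₁ yv).2 h' hqv.symm)
  have v₁qw : swapTable' e₁ yq yw = 0 := by by_contra h'; exact hpw.symm ((R₁ yw).2 h' hqw.symm)
  have v₂vp : swapTable' e₂ yv yp = 0 := by
    by_contra h'; exact (Finset.mem_sdiff.1 hf₀).2 (((R₂ yp).1 h' hpv) ▸ hpC)
  have v₂vq : swapTable' e₂ yv yq = 0 := by
    by_contra h'; exact (Finset.mem_sdiff.1 hf₀).2 (((R₂ yq).1 h' hqv) ▸ hqC)
  have v₂wp : swapTable' e₂ yw yp = 0 := by by_contra h'; exact hpv ((R₂ yp).2 h' hpw)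
  have v₂wq : swapTable' e₂ yw yq = 0 := by by_contra h'; exact hqv ((R₂ yq).2 h' hqw)
  have hunit : ∀ d, d ∈ A₁ \ C₁ ∨ d ∈ A₂ \ C₂ → ∀ q, swapTable' e₁ d q = (if q = d then 1 else 0) ∧
      swapTable' e₂ d q = (if q = d then 1 else 0) := by
    intro d hd q
    have hd₁ : d ∉ C₁ \ A₁ := by
      rcases hd with hd | hd
      · exact fun h' => (Finset.mem_sdiff.1 h').2 (Finset.mem_sdiff.1 hd).1
      · intro h'
        rw [hY₁] at h'
        simp only [Finset.mem_insert, Finset.mem_singleton] at h'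
        rcases h' with rfl | rfl
        · exact (Finset.mem_sdiff.1 hd).2 hpC
        · exact (Finset.mem_sdiff.1 hd).2 hqC
    have hd₂ : d ∉ C₂ \ A₂ := by
      rcases hd with hd | hd
      · intro h'
        rw [hY₂] at h'
        simp only [Finset.mem_insert, Finset.mem_singleton] at h'
        rcases h' with rfl | rfl
        · exact (Finset.mem_sdiff.1 hd).2 hvC
        · exact (Finset.mem_sdiff.1 hd).2 hwC
      · exact fun h' => (Finset.mem_sdiff.1 h').2 (Finset.mem_sdiff.1 hd).1
    exact ⟨row_unit A₁ C₁ e₁ m1 hd₁ q, row_unit A₂ C₂ e₂ n1 hd₂ q⟩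
  -- the combined table and what the movers read in it
  set w : Fin h → Fin h → ℂ := tab2 (fun a q => swapTable' e₁ a q - if q = a then 1 else 0)
      (fun a q => swapTable' e₂ a q - if q = a then 1 else 0) ε with hw
  have hwdef : ∀ y q, w y q = (if q = y then 1 else 0) + ε 0 * (swapTable' e₁ y q - if q = y then 1 else 0)
      + ε 1 * (swapTable' e₂ y q - if q = y then 1 else 0) := fun y q => rfl
  have hoff : ∀ y d, d ≠ y → w y d ≠ 0 → swapTable' e₁ y d ≠ 0 ∨ swapTable' e₂ y d ≠ 0 := by
    intro y d hdy hw0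
    by_contra hcon
    push Not at hcon
    apply hw0
    rw [hwdef, hcon.1, hcon.2, if_neg hdy]; ring
  have hreadp : ∀ d, d ≠ yp → w yp d ≠ 0 → d = x₀ := by
    intro d hd hw0
    rcases hoff yp d hd hw0 with h' | h'
    · exact (R₁ d).1 h' hd
    · exfalso; apply h'; rw [v₂p d, if_neg hd]
  have hreadq : ∀ d, d ≠ yq → w yq d ≠ 0 → d = yp := by
    intro d hd hw0
    rcases hoff yq d hd hw0 with h' | h'
    · exact (R₁ d).2 h' hd
    · exfalso; apply h'; rw [v₂q d, if_neg hd]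
  have hreadv : ∀ d, d ≠ yv → w yv d ≠ 0 → d = f₀ := by
    intro d hd hw0
    rcases hoff yv d hd hw0 with h' | h'
    · exfalso; apply h'; rw [v₁v d, if_neg hd]
    · exact (R₂ d).1 h' hd
  have hreadw : ∀ d, d ≠ yw → w yw d ≠ 0 → d = yv := by
    intro d hd hw0
    rcases hoff yw d hd hw0 with h' | h'
    · exfalso; apply h'; rw [v₁w d, if_neg hd]
    · exact (R₂ d).2 h' hd
  have hvq0 : w yv yq = 0 := by rw [hwdef, v₁v yq, v₂vq, if_neg hqv]; simp
  -- the inert part `Z = (A₁ ∩ C₁) ∖ {v, w}` of the start row `C₁`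
  obtain ⟨Z, hZdef⟩ : ∃ Z : Finset (Fin h), Z = ((A₁ ∩ C₁).erase yv).erase yw := ⟨_, rfl⟩
  have hvZ₁ : yv ∈ A₁ ∩ C₁ := Finset.mem_inter.2 ⟨hvA, hvC⟩
  have hwZ₁ : yw ∈ (A₁ ∩ C₁).erase yv := Finset.mem_erase.2 ⟨hvw.symm, Finset.mem_inter.2 ⟨hwA, hwC⟩⟩
  have hZsub : Z ⊆ A₁ ∩ C₁ := by rw [hZdef]; exact (Finset.erase_subset _ _).trans (Finset.erase_subset _ _)
  have hZc : Z.card + 3 = t := by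
    have h2 : 1 < (A₁ ∩ C₁).card := Finset.one_lt_card.2 ⟨yv, hvZ₁, yw, Finset.mem_inter.2 ⟨hwA, hwC⟩, hvw⟩
    rw [hZdef, Finset.card_erase_of_mem hwZ₁, Finset.card_erase_of_mem hvZ₁, a3]; rw [a3] at h2; omega
  have hvZ : yv ∉ Z := by
    rw [hZdef]; exact fun h' => (Finset.notMem_erase yv _) (Finset.mem_of_mem_erase h')
  have hwZ : yw ∉ Z := by rw [hZdef]; exact Finset.notMem_erase _ _
  have hZ₁eq : A₁ ∩ C₁ = insert yv (insert yw Z) := by rw [hZdef, Finset.insert_erase hwZ₁, Finset.insert_erase hvZ₁]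
  have hyZ : ∀ y, y ∉ A₁ → y ∉ Z := fun y hy h' => hy (Finset.mem_inter.1 (hZsub h')).1
  have hpZ := hyZ yp hypA₁
  have hqZ := hyZ yq hyqA₁
  have hM4 : ∀ d, d ∉ ({yp, yq, yv, yw} : Finset (Fin h)) ↔ d ≠ yp ∧ d ≠ yq ∧ d ≠ yv ∧ d ≠ yw := by
    intro d; simp only [Finset.mem_insert, Finset.mem_singleton, not_or]
  have hexit : ∀ d, d ≠ yp → d ≠ yq → d ≠ yv → d ≠ yw → (w yp d ≠ 0 ∨ w yq d ≠ 0 ∨ w yv d ≠ 0 ∨ w yw d ≠ 0) →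
      d ∈ A₁ \ C₁ ∨ d ∈ A₂ \ C₂ := by
    intro d hdp hdq hdv hdw hread
    rcases hread with h' | h' | h' | h'
    · exact Or.inl ((hreadp d hdp h') ▸ hx₀)
    · exact absurd (hreadq d hdq h') hdp
    · exact Or.inr ((hreadv d hdv h') ▸ hf₀)
    · exact absurd (hreadw d hdw h') hdv
  -- rows through `v` or `w`, and small rows, are present
  have hmov : ∀ S : Finset (Fin h), S.card ≤ t → (∃ y ∈ S, y ∉ A₂) → ∃ i, i ≠ i₀ ∧ rows i = S :=
    fun S hS ⟨y, hyS, hyA⟩ => key S hS fun hSA => hyA (hSA ▸ hyS)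
  have hcardT : ∀ T : Finset (Fin h), Disjoint T Z → T.card ≤ 3 → (T ∪ Z).card ≤ t := fun T hT hT3 => by
    rw [Finset.card_union_of_disjoint hT]; omega
  have hdisj3 : ∀ p q s : Fin h, p ∉ Z → q ∉ Z → s ∉ Z → Disjoint ({p, q, s} : Finset (Fin h)) Z := by
    intro p q s hp hq hs
    rw [Finset.disjoint_insert_left, Finset.disjoint_insert_left, Finset.disjoint_singleton_left]; exact ⟨hp, hq, hs⟩
  have hrowT : ∀ T : Finset (Fin h), (∃ y ∈ T, y ∉ A₂) → Disjoint T Z → T.card ≤ 3 → ∃ i, i ≠ i₀ ∧ rows i = T ∪ Z :=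
    fun T hy hT h3 => hmov _ (hcardT T hT h3) (by obtain ⟨y, hyT, hyA⟩ := hy; exact ⟨y, Finset.mem_union_left _ hyT, hyA⟩)
  refine det_eq_zero_of_chain₄' w rows cols i₀ Z hpq hpv hpw hqv hqw hvw hpZ hqZ hvZ hwZ
    ?_ ?_ ?_ ?_ ?_ ?_ ?_ ?_ ?_ ?_ ?_ ?_ ?_ ?_ ?_ ?_ ?_ ?_ ?_ ?_ ?_ ?_ ?_ ?_ ?_ ?_ ?_ ?_
  · -- unit rows on `Z`
    intro z hz q
    obtain ⟨hzA, hzC⟩ := Finset.mem_inter.1 (hZsub hz)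
    have hz₁ : z ∉ C₁ \ A₁ := fun h' => (Finset.mem_sdiff.1 h').2 hzA
    have hz₂ : z ∉ C₂ \ A₂ := by
      intro h'
      rw [hY₂] at h'
      simp only [Finset.mem_insert, Finset.mem_singleton] at h'
      rcases h' with rfl | rfl
      · exact hvZ hz
      · exact hwZ hz
    rw [hwdef, row_unit A₁ C₁ e₁ m1 hz₁ q, row_unit A₂ C₂ e₂ n1 hz₂ q]; ring
  · rw [hwdef, swapTable'_self, swapTable'_self, if_pos rfl]; ring
  · rw [hwdef, v₁pq, v₂p yq, if_neg hpq.symm]; simp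
  · rw [hwdef, v₁pv, v₂p yv, if_neg hpv.symm]; simp
  · rw [hwdef, v₁pw, v₂p yw, if_neg hpw.symm]; simp
  · rw [hwdef, swapTable'_self, swapTable'_self, if_pos rfl]; ring
  · rw [hwdef, v₁qv, v₂q yv, if_neg hqv.symm]; simp
  · rw [hwdef, v₁qw, v₂q yw, if_neg hqw.symm]; simp
  · rw [hwdef, swapTable'_self, swapTable'_self, if_pos rfl]; ring
  · rw [hwdef, v₁v yp, v₂vp, if_neg hpv]; simp
  · rw [hwdef, v₁v yw, v₂vw, if_neg hvw.symm]; simp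
  · rw [hwdef, swapTable'_self, swapTable'_self, if_pos rfl]; ring
  · rw [hwdef, v₁w yp, v₂wp, if_neg hpw]; simp
  · rw [hwdef, v₁w yq, v₂wq, if_neg hqw]; simp
  · -- read exits are attachments, hence unit rows
    intro d _ hdM hread q
    obtain ⟨hdp, hdq, hdv, hdw⟩ := (hM4 d).1 hdM
    have hd := hexit d hdp hdq hdv hdw hread
    rw [hwdef, (hunit d hd q).1, (hunit d hd q).2]; ring
  · -- the start row `C₁ = Z ∪ {p, q, v, w}`
    rw [hrow₀, eq_insert₂_inter hY₁, Finset.inter_comm, hZ₁eq]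
  · intro kk; rw [hZc]; exact hcolcard kk
  · -- small rows and mover rows (a three-element subset of the movers contains `v` or `w`)
    intro T hTZ hT _
    rcases hT with hT2 | ⟨hTM, hT3⟩
    · refine key _ (hcardT T hTZ (by omega)) fun hEq => ?_
      have h1 := Finset.card_union_of_disjoint hTZ; rw [hEq, hA₂] at h1; omega
    · by_cases hT2 : T.card ≤ 2
      · refine key _ (hcardT T hTZ hT3) fun hEq => ?_
        have h1 := Finset.card_union_of_disjoint hTZ; rw [hEq, hA₂] at h1; omega
      · have hT3' : T.card = 3 := by omega
        have hy : ∃ y ∈ T, y ≠ yp ∧ y ≠ yq := by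
          by_contra hcon
          push Not at hcon
          have hsub : T ⊆ {yp, yq} := by
            intro y hy
            rw [Finset.mem_insert, Finset.mem_singleton]
            by_cases h1 : y = yp
            · exact Or.inl h1
            · exact Or.inr (hcon y hy h1)
          have := Finset.card_le_card hsub
          rw [Finset.card_pair hpq] at this; omega
        obtain ⟨y, hyT, hyp, hyq⟩ := hy
        refine hmov _ (hcardT T hTZ hT3) ⟨y, Finset.mem_union_left _ hyT, ?_⟩
        have hyM := hTM hyT
        simp only [Finset.mem_insert, Finset.mem_singleton] at hyM
        rcases hyM with rfl | rfl | rfl | rfl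
        · exact absurd rfl hyp
        · exact absurd rfl hyq
        · exact hyvA₂
        · exact hywA₂
  · -- `Z ∪ {p, q, d}` with `d` read by `v`: `d = f₀`, and `Z ∪ {p, q, f₀} = A₂` would force `C₂ ⊆ C₁`
    intro d hdZ hdM hread
    obtain ⟨hdp, hdq, hdv, hdw⟩ := (hM4 d).1 hdM
    have hvd : w yv d ≠ 0 := by
      rcases hread with h' | ⟨hs, _⟩
      · exact h'
      · exact absurd hvq0 hs
    have hdf : d = f₀ := hreadv d hdv hvd
    refine key _ (hcardT _ (hdisj3 yp yq d hpZ hqZ hdZ) Finset.card_le_three) fun hEq => ?_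
    have hsub : C₂ ⊆ C₁ := by
      intro x hx
      by_cases hxA : x ∈ A₂
      · have hx' : x ∈ ({yp, yq, d} : Finset (Fin h)) ∪ Z := by rw [hEq]; exact hxA
        rw [Finset.mem_union] at hx'
        rcases hx' with hxT | hxZ
        · simp only [Finset.mem_insert, Finset.mem_singleton] at hxT
          rcases hxT with rfl | rfl | rfl
          · exact hypC₁
          · exact hyqC₁
          · exact absurd hx (Finset.mem_sdiff.1 (hdf ▸ hf₀)).2
        · exact (Finset.mem_inter.1 (hZsub hxZ)).2
      · have hxY : x ∈ C₂ \ A₂ := Finset.mem_sdiff.2 ⟨hx, hxA⟩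
        rw [hY₂, Finset.mem_insert, Finset.mem_singleton] at hxY
        rcases hxY with rfl | rfl
        · exact hvC
        · exact hwC
    exact hC (Finset.eq_of_subset_of_card_le hsub (by rw [hC₁, hC₂])).symm
  · intro d hdZ _ _ _; exact hrowT _ ⟨yv, by simp, hyvA₂⟩ (hdisj3 yp yv d hpZ hvZ hdZ) Finset.card_le_three
  · intro d hdZ _ _; exact hrowT _ ⟨yw, by simp, hywA₂⟩ (hdisj3 yp yw d hpZ hwZ hdZ) Finset.card_le_three
  · intro d hdZ _ _ _; exact hrowT _ ⟨yv, by simp, hyvA₂⟩ (hdisj3 yq yv d hqZ hvZ hdZ) Finset.card_le_three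
  · intro d hdZ _ _ _; exact hrowT _ ⟨yw, by simp, hywA₂⟩ (hdisj3 yq yw d hqZ hwZ hdZ) Finset.card_le_three
  · intro d hdZ _ _; exact hrowT _ ⟨yv, by simp, hyvA₂⟩ (hdisj3 yv yw d hvZ hwZ hdZ) Finset.card_le_three
  · intro d d' _ _ _ _ _ hs; exact absurd hvq0 hs
  · intro d d' _ _ _ _ _ hs; exact absurd hvq0 hs
  · intro d d' _ hdZ hd'Z _ _ _ _ _; exact hrowT _ ⟨yw, by simp, hywA₂⟩ (hdisj3 yw d d' hwZ hdZ hd'Z) Finset.card_le_three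
  · intro d d' d'' _ _ _ _ _ _ _ _ _ hs; exact absurd hvq0 hs

end SecondShell

end

end Summit.ValiantsHypothesis.ValiantsHypothesis.Theorems.BarrierLever.HiddenStates
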